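import Literature.MathematicalPhysics.QuantumFieldTheory.Balaban1983to89.T3MinimiserStabilityReduction
import Literature.MathematicalPhysics.QuantumFieldTheory.Balaban1983to89.T3PrintedRegularMinimiser
import Literature.MathematicalPhysics.QuantumFieldTheory.Balaban1983to89.T3OrbitAverage
import Literature.MathematicalPhysics.QuantumFieldTheory.Balaban1983to89.B12ContinuousTransportInvariance
import Literature.MathematicalPhysics.QuantumFieldTheory.Balaban1983to89.Node00.CanonicalTransportOfRecord
import HarnessLib

/-!
# LINE g17-2 — RE-TYPED ROWS OVER THE CANONICAL VERSION (OFFER of the PLUMB hand ym-ust-plumb-1 g0 to the line owner ym-r3-idea-1 / critic idea-crit-5)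

Companion of `Lines/semiclassical_s2beta_plumb_version.lean` (the STUB-MISSTATED certificate for `stub_oneLoopPlumbing`): the skeleton
`Lines/semiclassical_s2beta.lean` v3a types its rows 1L4 `OneLoopClustered`, H4 `BeyondOneLoopSmall`, LFR♯ `LargeFieldFourPt` (and LINE g17-1's
SFR/LFR) on POINTWISE values of the trunk's `heightDensity`, which at depth `K − J ≥ 1` is `ENNReal.toReal` of Mathlib's `Measure.rnDeriv` — a
`Classical.choose`-selected representative of an a.e.-class.  Pointwise clauses about it (positivity on the window, the λ-limit of `Δ² log`) can be
neither proved nor refuted; the ORGANS EXW/GAP do not mention it, so PLUMB `EXW → GAP → 1L4` is provable only by refuting an organ.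

THE ONE-TOKEN REPAIR offered here (tree precedent: NODE 00 row P7, `Node00.CanonicalTransportOfRecord.TcanOfRecord`): read the restricted density
through ITS CANONICAL VERSION `heightDensityCan := Node00.canonVersion (fieldMeasure …) (heightDensity …)` — a.e. equal to `heightDensity` (so every trunk
identity holds for it, §1), continuous on the maximal open set `regSet` on which the a.e.-class HAS a continuous representative, and there POINTWISE
DETERMINED (equal to every continuous representative, `heightDensityCan_eqOn_of_continuousOn`).  The rows become (§2): 1L4ᶜ = (R) the window lies in
`regSet` for every `λ ≥ 1` (the small-field fibre density HAS a continuous version on the window — the honest analytic content: coarea / fibrewise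
level-set nullity / positivity, cf. the P7 locator audit (F1)–(F3)) ∧ (P) positivity of the canonical version on the window ∧ (T) existence and
κ-clustering of the semiclassical limit of `Δ² (log heightDensityCan(γ/λ) + β_K(γ/λ)·minActionRegPr)`; H4ᶜ, LFR♯ᶜ = the same substitution.  The
composition 1L4ᶜ → H4ᶜ → LFR♯ᶜ → S2β is PROVED verbatim (§2, S2β's text UNCHANGED: it quantifies over continuous versions `ρ` and is version-free), and
the corrected PLUMB signature is `stub_oneLoopPlumbingCan : WindowExactness → UniformFibreGap → OneLoopClusteredCan` (§3, organs restated verbatim from v3a).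

COUNT-NEUTRAL OFFER: not registered, not a skeleton edit; adopting it is the line owner's decision.  Nothing of Bałaban's asserted; no summit, crux or stub
proved; `YM3TorusSU2` NOT proved; YM mass gap NOT proved.
-/

noncomputable section

open MeasureTheory Filter Topology Set
open Literature.MathematicalPhysics.QuantumFieldTheory.Balaban1983to89
open Literature.MathematicalPhysics.QuantumFieldTheory.Balaban1983to89.T3ContinuumYM3Torus
open Literature.MathematicalPhysics.QuantumFieldTheory.Balaban1983to89.T3NestedUnitLaws
open Literature.MathematicalPhysics.QuantumFieldTheory.Balaban1983to89.T3UnitLawDensityEML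
open Literature.MathematicalPhysics.QuantumFieldTheory.Balaban1983to89.T3UnitScaleTilt
open Literature.MathematicalPhysics.QuantumFieldTheory.Balaban1983to89.T3TiltDescent
open Literature.MathematicalPhysics.QuantumFieldTheory.Balaban1983to89.T3PrintedRegularMinimiser
open Literature.MathematicalPhysics.QuantumFieldTheory.Balaban1983to89.T3ConstrainedMinimiser (fibre)
open Literature.MathematicalPhysics.QuantumFieldTheory.Balaban1983to89.T3LevelShift
open Literature.MathematicalPhysics.QuantumFieldTheory.Balaban1983to89.Missing
open Literature.MathematicalPhysics.QuantumFieldTheory.Balaban1983to89.T4Continuum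
open scoped Literature.MathematicalPhysics.QuantumFieldTheory.Balaban1983to89.T3OrbitAverage

namespace Summit.QuantumFields.YangMills.Cruxes.FluctuationComparisonRegPrIntL.RunPairOrgan.OneLoop

/-! ## §1 The canonical version of the restricted height density and its unconditional faces -/

section Canonical

variable (F : T3Family) (γ : ℝ) {J K : ℕ} (hJK : J ≤ K) (S : Set (GaugeField (F.P K) 0 (Matrix.specialUnitaryGroup (Fin 2) ℂ)))

/-- **THE CANONICAL VERSION OF BAŁABAN'S RESTRICTED DENSITY AT HEIGHT `K − J`** read on the `J`-th tower's finest lattice: the trunk's `heightDensity`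
(a chosen Radon–Nikodym version) replaced by `Node00.canonVersion` of its a.e.-class for product Haar — continuous on the maximal open set carrying a
continuous representative and equal there to every such representative. [cite: Balaban1985UV3, (2) p.256 and (41) p.266] -/
def heightDensityCan (V : GaugeField (F.P J) 0 (Matrix.specialUnitaryGroup (Fin 2) ℂ)) : ℝ :=
  Node00.canonVersion (fieldMeasure (F.P J) 0 (Matrix.specialUnitaryGroup (Fin 2) ℂ)) (heightDensity F γ hJK S) V

/-- The canonical version IS a version: `heightDensityCan = heightDensity` a.e. (no hypothesis). [cite: Balaban1985UV3, (2) p.256] -/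
theorem heightDensityCan_ae_eq :
    heightDensityCan F γ hJK S =ᵐ[fieldMeasure (F.P J) 0 (Matrix.specialUnitaryGroup (Fin 2) ℂ)] heightDensity F γ hJK S :=
  Node00.canonVersion_ae_eq

variable {γ S}

/-- Hence the trunk's density identity holds for it: `(D_{J,K})_*(Gibbs_K|S) = dV.withDensity (Z_K⁻¹ · heightDensityCan)` (`γ ≥ 0`, `S` measurable).
[cite: Balaban1985UV3, (2) p.256 + (6) p.257] -/
theorem map_descendTo_restrict_eq_withDensity_can (hS : MeasurableSet S) (hγ : 0 ≤ γ) :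
    Measure.map (descendTo F ℰp J K hJK) ((gibbsK F ℰp γ K).restrict S) =
      (fieldMeasure (F.P J) 0 (Matrix.specialUnitaryGroup (Fin 2) ℂ)).withDensity (fun V => ENNReal.ofReal
        ((partitionFn (G := Matrix.specialUnitaryGroup (Fin 2) ℂ) (F.P K) ((F.scheme ℰp γ).β K))⁻¹ * heightDensityCan F γ hJK S V)) := by
  rw [map_descendTo_restrict_eq_withDensity F hJK hS hγ]
  refine withDensity_congr_ae ?_
  filter_upwards [heightDensityCan_ae_eq F γ hJK S] with V hV
  rw [hV]

variable (γ S)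

/-- **POINTWISE DETERMINACY**: on every OPEN set of coarse fields on which SOME a.e.-representative `g` of the restricted density is continuous, the canonical
version equals `g` at every point. [cite: Balaban1985UV3, (2) p.256] -/
theorem heightDensityCan_eqOn_of_continuousOn {U : Set (GaugeField (F.P J) 0 (Matrix.specialUnitaryGroup (Fin 2) ℂ))} (hU : IsOpen U)
    {g : GaugeField (F.P J) 0 (Matrix.specialUnitaryGroup (Fin 2) ℂ) → ℝ} (hg : ContinuousOn g U)
    (hae : g =ᵐ[(fieldMeasure (F.P J) 0 (Matrix.specialUnitaryGroup (Fin 2) ℂ)).restrict U] heightDensity F γ hJK S) :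
    EqOn (heightDensityCan F γ hJK S) g U := by
  haveI := B12ContinuousTransportInvariance.isOpenPosMeasure_fieldMeasure_SU (N := 2) (F.P J) 0
  exact Node00.canonVersion_eqOn_of_continuousOn hU hg hae

/-- The canonical version is continuous on the maximal regular open set of the a.e.-class. [cite: Balaban1985UV3, (2) p.256] -/
theorem continuousOn_heightDensityCan :
    ContinuousOn (heightDensityCan F γ hJK S)
      (Node00.regSet (fieldMeasure (F.P J) 0 (Matrix.specialUnitaryGroup (Fin 2) ℂ)) (heightDensity F γ hJK S)) := by
  haveI := B12ContinuousTransportInvariance.isOpenPosMeasure_fieldMeasure_SU (N := 2) (F.P J) 0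
  exact Node00.continuousOn_canonVersion

end Canonical

/-! ## §2 The rows re-typed over the canonical version, S2β verbatim, and the PROVED composition -/

section Rows

/-- The connected 4-point (mixed second difference) — verbatim from v3a. [cite: Balaban1985UV3, (41) p.266] -/
def fourPt {X : Type*} (f : X → ℝ) (U V W Z : X) : ℝ := (f U - f V) - (f W - f Z)

variable (F : T3Family) (γ b₀ p₀ ε₀ : ℝ) {J K : ℕ} (hJK : J ≤ K)

/-- **THE λ-SCALED FLUCTUATION PART OVER THE CANONICAL VERSION** `f^λ(V) := log heightDensityCan F (γ/λ) (histGood at θBal(γ)) V + β_K(γ/λ)·minActionRegPr(V)`.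
[cite: Balaban1985UV3, (2) p.256 and (41) p.266] -/
def fluctAtCan (lam : ℝ) (V : GaugeField (F.P J) 0 (Matrix.specialUnitaryGroup (Fin 2) ℂ)) : ℝ :=
  Real.log (heightDensityCan F (γ / lam) hJK (histGood F ℰp (θBal F.L γ b₀ p₀) K J) V)
    + (F.scheme ℰp (γ / lam)).β K * minActionRegPr F J K hJK ε₀ V

/-- **THE CANONICAL ONE-LOOP 4-POINT** `Λ₄ := lim_{λ→∞} Δ² f^λ` over the canonical version (junk if the limit does not exist; 1L4ᶜ asserts it does).
[cite: Balaban1985Variational, Thm 1 (8)-(10) p.279] -/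
def oneLoopFourPtCan (U V W Z : GaugeField (F.P J) 0 (Matrix.specialUnitaryGroup (Fin 2) ℂ)) : ℝ :=
  limUnder atTop (fun lam : ℝ => fourPt (fluctAtCan F γ b₀ p₀ ε₀ hJK lam) U V W Z)

/-- At `λ = 1`: S2β's integrand with the canonical small-history density. [cite: Balaban1985UV3, (41) p.266] -/
theorem fluctAtCan_one (V : GaugeField (F.P J) 0 (Matrix.specialUnitaryGroup (Fin 2) ℂ)) :
    fluctAtCan F γ b₀ p₀ ε₀ hJK 1 V =
      Real.log (heightDensityCan F γ hJK (histGood F ℰp (θBal F.L γ b₀ p₀) K J) V)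
        + (F.scheme ℰp γ).β K * minActionRegPr F J K hJK ε₀ V := by
  simp only [fluctAtCan, div_one]

/-- Whenever the λ-scaled 4-point has SOME limit `a`, the canonical one-loop 4-point equals it. [cite: Balaban1985Variational, Thm 1 (8) p.279] -/
theorem oneLoopFourPtCan_eq_of_tendsto (U V W Z : GaugeField (F.P J) 0 (Matrix.specialUnitaryGroup (Fin 2) ℂ)) {a : ℝ}
    (h : Tendsto (fun lam : ℝ => fourPt (fluctAtCan F γ b₀ p₀ ε₀ hJK lam) U V W Z) atTop (𝓝 a)) :
    oneLoopFourPtCan F γ b₀ p₀ ε₀ hJK U V W Z = a := by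
  unfold oneLoopFourPtCan; exact h.limUnder_eq

/-- **1L4ᶜ · ONE-LOOP 4-POINTS EXIST AND ARE CLUSTERED, OVER THE CANONICAL VERSION** (re-typing of v3a's `OneLoopClustered`): same prefix; for every run `K`
and height `J ≤ K`: **(R)** for every `λ ≥ 1` the window lies in the maximal regular open set of the restricted density at coupling `γ/λ` (the small-field
fibre density HAS a continuous version on the window — coarea form of the push-forward, fibrewise nullity of the threshold level sets, [Balaban1985Averaging]
(10)); **(P)** the canonical version is positive on the window for every `λ ≥ 1`; **(T)** at every window quadrilateral the semiclassical limit of the 4-point of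
`f^λ` exists and is κ-clustered of size `≤ φ₁ J`, `J·φ₁ J → 0`, depth-uniform.  Mechanism and risks as in v3a's 1L4, PLUS the honest analytic content of (R).
[cite: Balaban1985Variational, Thm 1 (8)-(10) p.279; Balaban1985Averaging, (10) p.19] -/
def OneLoopClusteredCan : Prop :=
  ∀ (L : ℕ), ∃ pS : ℝ, ∀ (b₀ p₀ : ℝ), 0 < b₀ → pS ≤ p₀ → 0 < p₀ → ∃ ε₁ : ℝ, 0 < ε₁ ∧ ∀ (ε₀ : ℝ), 0 < ε₀ → ε₀ ≤ ε₁ →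
    ∃ γ₁ : ℝ, 0 < γ₁ ∧ ∃ κ : ℝ, 0 < κ ∧ ∀ (F : T3Family) (γ : ℝ), F.L = L → 0 < γ → γ ≤ γ₁ →
      ∃ φ₁ : ℕ → ℝ, (∀ J, 0 ≤ φ₁ J) ∧ Tendsto (fun J : ℕ => (J : ℝ) * φ₁ J) atTop (𝓝 0) ∧
        ∀ (J K : ℕ) (hJK : J ≤ K),
          (∀ lam : ℝ, 1 ≤ lam →
            {U : GaugeField (F.P J) 0 (Matrix.specialUnitaryGroup (Fin 2) ℂ) | PlaqSmall (θBal F.L γ b₀ p₀ J) U} ⊆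
              Node00.regSet (fieldMeasure (F.P J) 0 (Matrix.specialUnitaryGroup (Fin 2) ℂ))
                (heightDensity F (γ / lam) hJK (histGood F ℰp (θBal F.L γ b₀ p₀) K J))) ∧
          (∀ lam : ℝ, 1 ≤ lam → ∀ U : GaugeField (F.P J) 0 (Matrix.specialUnitaryGroup (Fin 2) ℂ), PlaqSmall (θBal F.L γ b₀ p₀ J) U →
              0 < heightDensityCan F (γ / lam) hJK (histGood F ℰp (θBal F.L γ b₀ p₀) K J) U) ∧
          ∀ (b b' : PBond (F.P J) 0) (U V W Z : GaugeField (F.P J) 0 (Matrix.specialUnitaryGroup (Fin 2) ℂ)),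
            PlaqSmall (θBal F.L γ b₀ p₀ J) U → PlaqSmall (θBal F.L γ b₀ p₀ J) V →
            PlaqSmall (θBal F.L γ b₀ p₀ J) W → PlaqSmall (θBal F.L γ b₀ p₀ J) Z →
            (∀ e, e ≠ b → U e = V e) → (∀ e, e ≠ b' → U e = W e) → (∀ e, e ≠ b' → V e = Z e) → (∀ e, e ≠ b → W e = Z e) →
            Tendsto (fun lam : ℝ => fourPt (fluctAtCan F γ b₀ p₀ ε₀ hJK lam) U V W Z) atTop
                (𝓝 (oneLoopFourPtCan F γ b₀ p₀ ε₀ hJK U V W Z)) ∧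
              |oneLoopFourPtCan F γ b₀ p₀ ε₀ hJK U V W Z| ≤ φ₁ J * Real.exp (-(κ * (b.src.tdist b'.src : ℝ)))

/-- **H4ᶜ · BEYOND ONE LOOP, OVER THE CANONICAL VERSION** (re-typing of v3a's `BeyondOneLoopSmall`): the `λ = 1` connected 4-point of `f^λ` differs from its
semiclassical limit by a κ-clustered `≤ φ₂ J`, `J·φ₂ J → 0`, depth-uniform. [cite: Balaban1985UV3, (45)-(47) p.267; Balaban1987RG1, Thm 1 (0.19)-(0.26)] -/
def BeyondOneLoopSmallCan : Prop :=
  ∀ (L : ℕ), ∃ pS : ℝ, ∀ (b₀ p₀ : ℝ), 0 < b₀ → pS ≤ p₀ → 0 < p₀ → ∃ ε₁ : ℝ, 0 < ε₁ ∧ ∀ (ε₀ : ℝ), 0 < ε₀ → ε₀ ≤ ε₁ →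
    ∃ γ₁ : ℝ, 0 < γ₁ ∧ ∃ κ : ℝ, 0 < κ ∧ ∀ (F : T3Family) (γ : ℝ), F.L = L → 0 < γ → γ ≤ γ₁ →
      ∃ φ₂ : ℕ → ℝ, (∀ J, 0 ≤ φ₂ J) ∧ Tendsto (fun J : ℕ => (J : ℝ) * φ₂ J) atTop (𝓝 0) ∧
        ∀ (J K : ℕ) (hJK : J ≤ K) (b b' : PBond (F.P J) 0) (U V W Z : GaugeField (F.P J) 0 (Matrix.specialUnitaryGroup (Fin 2) ℂ)),
          PlaqSmall (θBal F.L γ b₀ p₀ J) U → PlaqSmall (θBal F.L γ b₀ p₀ J) V →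
          PlaqSmall (θBal F.L γ b₀ p₀ J) W → PlaqSmall (θBal F.L γ b₀ p₀ J) Z →
          (∀ e, e ≠ b → U e = V e) → (∀ e, e ≠ b' → U e = W e) → (∀ e, e ≠ b' → V e = Z e) → (∀ e, e ≠ b → W e = Z e) →
          |fourPt (fluctAtCan F γ b₀ p₀ ε₀ hJK 1) U V W Z - oneLoopFourPtCan F γ b₀ p₀ ε₀ hJK U V W Z|
            ≤ φ₂ J * Real.exp (-(κ * (b.src.tdist b'.src : ℝ)))

/-- **LFR♯ᶜ · LARGE-FIELD 4-POINT REMAINDER, OVER THE CANONICAL VERSION** (re-typing of v3a's `LargeFieldFourPt`): for every continuous positive window version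
`ρ` of the full nested law, `log ρ − log heightDensityCan^{histGood}` has κ-clustered connected 4-points `≤ ψ J`, `J·ψ J → 0`, depth-uniform, given positivity
of the canonical small-history density on the window. [cite: Balaban1988Convergent, §2 (2.18)-(2.27); Balaban1989LargeFieldI, §1] -/
def LargeFieldFourPtCan : Prop :=
  ∀ (L : ℕ), ∃ pS : ℝ, ∀ (b₀ p₀ : ℝ), 0 < b₀ → pS ≤ p₀ → 0 < p₀ →
    ∃ γ₁ : ℝ, 0 < γ₁ ∧ ∃ κ : ℝ, 0 < κ ∧ ∀ (F : T3Family) (γ : ℝ), F.L = L → 0 < γ → γ ≤ γ₁ →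
      ∃ ψ : ℕ → ℝ, (∀ J, 0 ≤ ψ J) ∧ Tendsto (fun J : ℕ => (J : ℝ) * ψ J) atTop (𝓝 0) ∧
        ∀ (ν : ℕ → (j : ℕ) → Measure (GaugeField (F.P j) 0 (Matrix.specialUnitaryGroup (Fin 2) ℂ))),
          (∀ K, ν K K = T4GenFunBounds.gibbsMeasure (F.P K) ((F.scheme ℰp γ).β K)) →
          (∀ K j, j < K → ν K j = Measure.map (descend F ℰp j) (ν K (j + 1))) →
          ∀ (J K : ℕ) (hJK : J ≤ K) (ρ : GaugeField (F.P J) 0 (Matrix.specialUnitaryGroup (Fin 2) ℂ) → ℝ),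
            (∀ U, PlaqSmall (θBal F.L γ b₀ p₀ J) U → 0 < ρ U) →
            ν K J = (fieldMeasure _ _ _).withDensity (fun U => ENNReal.ofReal (ρ U)) →
            ContinuousOn ρ {U | PlaqSmall (θBal F.L γ b₀ p₀ J) U} →
            (∀ U : GaugeField (F.P J) 0 (Matrix.specialUnitaryGroup (Fin 2) ℂ), PlaqSmall (θBal F.L γ b₀ p₀ J) U →
                0 < heightDensityCan F γ hJK (histGood F ℰp (θBal F.L γ b₀ p₀) K J) U) →
            ∀ (b b' : PBond (F.P J) 0) (U V W Z : GaugeField (F.P J) 0 (Matrix.specialUnitaryGroup (Fin 2) ℂ)),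
              PlaqSmall (θBal F.L γ b₀ p₀ J) U → PlaqSmall (θBal F.L γ b₀ p₀ J) V →
              PlaqSmall (θBal F.L γ b₀ p₀ J) W → PlaqSmall (θBal F.L γ b₀ p₀ J) Z →
              (∀ e, e ≠ b → U e = V e) → (∀ e, e ≠ b' → U e = W e) → (∀ e, e ≠ b' → V e = Z e) → (∀ e, e ≠ b → W e = Z e) →
              |fourPt (fun U => Real.log (ρ U) - Real.log (heightDensityCan F γ hJK (histGood F ℰp (θBal F.L γ b₀ p₀) K J) U)) U V W Z|
                ≤ ψ J * Real.exp (-(κ * (b.src.tdist b'.src : ℝ)))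

/-- **S2β · FLUCTUATION PART SMALL IN 4-POINT CURRENCY** — VERBATIM from the package `Lines/runpair_organ.lean` v15 / skeleton v3a (version-free: it quantifies
over continuous positive versions `ρ`). [cite: Balaban1985UV3, Thm 2 p.263 and (41) p.266] -/
def FluctuationPartSmall : Prop :=
  ∀ (L : ℕ), ∃ pS : ℝ, ∀ (b₀ p₀ : ℝ), 0 < b₀ → pS ≤ p₀ → 0 < p₀ → ∃ ε₁ : ℝ, 0 < ε₁ ∧ ∀ (ε₀ : ℝ), 0 < ε₀ → ε₀ ≤ ε₁ →
    ∃ γ₁ : ℝ, 0 < γ₁ ∧ ∃ κ : ℝ, 0 < κ ∧ ∀ (F : T3Family) (γ : ℝ), F.L = L → 0 < γ → γ ≤ γ₁ →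
      ∃ (φ : ℕ → ℝ), (∀ J, 0 ≤ φ J) ∧ Tendsto (fun J : ℕ => (J : ℝ) * φ J) atTop (𝓝 0) ∧
        ∀ (ν : ℕ → (j : ℕ) → Measure (GaugeField (F.P j) 0 (Matrix.specialUnitaryGroup (Fin 2) ℂ))),
          (∀ K, ν K K = T4GenFunBounds.gibbsMeasure (F.P K) ((F.scheme ℰp γ).β K)) →
          (∀ K j, j < K → ν K j = Measure.map (descend F ℰp j) (ν K (j + 1))) →
          ∀ (J K : ℕ) (hJK : J ≤ K) (ρ : GaugeField (F.P J) 0 (Matrix.specialUnitaryGroup (Fin 2) ℂ) → ℝ),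
            (∀ U, PlaqSmall (θBal F.L γ b₀ p₀ J) U → 0 < ρ U) →
            ν K J = (fieldMeasure _ _ _).withDensity (fun U => ENNReal.ofReal (ρ U)) →
            ContinuousOn ρ {U | PlaqSmall (θBal F.L γ b₀ p₀ J) U} →
            ∀ (b b' : PBond (F.P J) 0) (U V W Z : GaugeField (F.P J) 0 (Matrix.specialUnitaryGroup (Fin 2) ℂ)),
              PlaqSmall (θBal F.L γ b₀ p₀ J) U → PlaqSmall (θBal F.L γ b₀ p₀ J) V →
              PlaqSmall (θBal F.L γ b₀ p₀ J) W → PlaqSmall (θBal F.L γ b₀ p₀ J) Z →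
              (∀ e, e ≠ b → U e = V e) → (∀ e, e ≠ b' → U e = W e) → (∀ e, e ≠ b' → V e = Z e) → (∀ e, e ≠ b → W e = Z e) →
              |((Real.log (ρ U) + (F.scheme ℰp γ).β K * minActionRegPr F J K hJK ε₀ U)
                  - (Real.log (ρ V) + (F.scheme ℰp γ).β K * minActionRegPr F J K hJK ε₀ V))
                - ((Real.log (ρ W) + (F.scheme ℰp γ).β K * minActionRegPr F J K hJK ε₀ W)
                  - (Real.log (ρ Z) + (F.scheme ℰp γ).β K * minActionRegPr F J K hJK ε₀ Z))|
                ≤ φ J * Real.exp (-(κ * (b.src.tdist b'.src : ℝ)))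

/-- **COMPOSITION · 1L4ᶜ → H4ᶜ → LFR♯ᶜ → S2β (PROVED, verbatim from v3a with the canonical version)**: `log ρ + β_K S = f¹ + (log ρ − log g)` with
`g = heightDensityCan` and `f¹ = fluctAtCan … 1`, `|Δ²f¹| ≤ |Λ₄| + |Δ²f¹ − Λ₄|`, `κ := min`, `φ := φ₁ + φ₂ + ψ`.
[cite: Balaban1985UV3, (41) p.266; Balaban1985Variational, Thm 1 (8) p.279] -/
theorem fluctuationPartSmall_of_semiclassicalCan (h1 : OneLoopClusteredCan) (h2 : BeyondOneLoopSmallCan) (h3 : LargeFieldFourPtCan) :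
    FluctuationPartSmall := by
  intro L
  obtain ⟨pS₁, H1⟩ := h1 L
  obtain ⟨pS₂, H2⟩ := h2 L
  obtain ⟨pS₃, H3⟩ := h3 L
  refine ⟨max pS₁ (max pS₂ pS₃), fun b₀ p₀ hb hpS hp => ?_⟩
  have hp1 : pS₁ ≤ p₀ := (le_max_left _ _).trans hpS
  have hp2 : pS₂ ≤ p₀ := ((le_max_left _ _).trans (le_max_right _ _)).trans hpS
  have hp3 : pS₃ ≤ p₀ := ((le_max_right _ _).trans (le_max_right _ _)).trans hpS
  obtain ⟨ε₁, hε₁, H1⟩ := H1 b₀ p₀ hb hp1 hp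
  obtain ⟨ε₂, hε₂, H2⟩ := H2 b₀ p₀ hb hp2 hp
  obtain ⟨γ₃, hγ₃, κ₃, hκ₃, H3⟩ := H3 b₀ p₀ hb hp3 hp
  refine ⟨min ε₁ ε₂, lt_min hε₁ hε₂, fun ε₀ hε₀ hε₀1 => ?_⟩
  obtain ⟨γ₁, hγ₁, κ₁, hκ₁, H1⟩ := H1 ε₀ hε₀ (hε₀1.trans (min_le_left _ _))
  obtain ⟨γ₂, hγ₂, κ₂, hκ₂, H2⟩ := H2 ε₀ hε₀ (hε₀1.trans (min_le_right _ _))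
  refine ⟨min γ₁ (min γ₂ γ₃), lt_min hγ₁ (lt_min hγ₂ hγ₃), min κ₁ (min κ₂ κ₃), lt_min hκ₁ (lt_min hκ₂ hκ₃),
    fun F γ hFL hγ hγle => ?_⟩
  obtain ⟨φ₁, hφ₁0, hφ₁t, H1⟩ := H1 F γ hFL hγ (hγle.trans (min_le_left _ _))
  obtain ⟨φ₂, hφ₂0, hφ₂t, H2⟩ := H2 F γ hFL hγ (hγle.trans ((min_le_right _ _).trans (min_le_left _ _)))
  obtain ⟨ψ, hψ0, hψt, H3⟩ := H3 F γ hFL hγ (hγle.trans ((min_le_right _ _).trans (min_le_right _ _)))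
  refine ⟨fun J => φ₁ J + φ₂ J + ψ J, fun J => ?_, ?_, ?_⟩
  · have := hφ₁0 J; have := hφ₂0 J; have := hψ0 J; positivity
  · have h := (hφ₁t.add hφ₂t).add hψt
    rw [add_zero, add_zero] at h
    refine h.congr' (Eventually.of_forall fun J => ?_)
    show (J : ℝ) * φ₁ J + (J : ℝ) * φ₂ J + (J : ℝ) * ψ J = (J : ℝ) * (φ₁ J + φ₂ J + ψ J)
    ring
  · intro ν hνK hνd J K hJK ρ hρpos hνρ hρcont b b' U V W Z hU hV hW hZ hUV hUW hVZ hWZ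
    obtain ⟨-, hgposAll, H1q⟩ := H1 J K hJK
    have hgpos : ∀ U : GaugeField (F.P J) 0 (Matrix.specialUnitaryGroup (Fin 2) ℂ), PlaqSmall (θBal F.L γ b₀ p₀ J) U →
        0 < heightDensityCan F γ hJK (histGood F ℰp (θBal F.L γ b₀ p₀) K J) U := by
      intro U hU
      have := hgposAll 1 le_rfl U hU
      simpa only [div_one] using this
    obtain ⟨-, hΛ⟩ := H1q b b' U V W Z hU hV hW hZ hUV hUW hVZ hWZ
    have hq := H2 J K hJK b b' U V W Z hU hV hW hZ hUV hUW hVZ hWZ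
    have hl := H3 ν hνK hνd J K hJK ρ hρpos hνρ hρcont hgpos b b' U V W Z hU hV hW hZ hUV hUW hVZ hWZ
    set g : GaugeField (F.P J) 0 (Matrix.specialUnitaryGroup (Fin 2) ℂ) → ℝ :=
      fun U => heightDensityCan F γ hJK (histGood F ℰp (θBal F.L γ b₀ p₀) K J) U with hg
    set B : GaugeField (F.P J) 0 (Matrix.specialUnitaryGroup (Fin 2) ℂ) → ℝ :=
      fun U => (F.scheme ℰp γ).β K * minActionRegPr F J K hJK ε₀ U with hB
    set Λ : ℝ := oneLoopFourPtCan F γ b₀ p₀ ε₀ hJK U V W Z with hΛdef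
    set d : ℝ := (b.src.tdist b'.src : ℝ) with hd
    have hd0 : 0 ≤ d := by rw [hd]; exact Nat.cast_nonneg _
    have hf1 : fourPt (fluctAtCan F γ b₀ p₀ ε₀ hJK 1) U V W Z
        = ((Real.log (g U) + B U) - (Real.log (g V) + B V)) - ((Real.log (g W) + B W) - (Real.log (g Z) + B Z)) := by
      simp only [fourPt, fluctAtCan_one, hg, hB]
    have hsplit : ((Real.log (ρ U) + B U) - (Real.log (ρ V) + B V)) - ((Real.log (ρ W) + B W) - (Real.log (ρ Z) + B Z))
        = fourPt (fluctAtCan F γ b₀ p₀ ε₀ hJK 1) U V W Z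
          + fourPt (fun U => Real.log (ρ U) - Real.log (g U)) U V W Z := by
      rw [hf1]; simp only [fourPt]; ring
    have e1 : Real.exp (-(κ₁ * d)) ≤ Real.exp (-(min κ₁ (min κ₂ κ₃) * d)) :=
      Real.exp_le_exp.mpr (by nlinarith [min_le_left κ₁ (min κ₂ κ₃)])
    have e2 : Real.exp (-(κ₂ * d)) ≤ Real.exp (-(min κ₁ (min κ₂ κ₃) * d)) :=
      Real.exp_le_exp.mpr (by nlinarith [min_le_right κ₁ (min κ₂ κ₃), min_le_left κ₂ κ₃])
    have e3 : Real.exp (-(κ₃ * d)) ≤ Real.exp (-(min κ₁ (min κ₂ κ₃) * d)) :=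
      Real.exp_le_exp.mpr (by nlinarith [min_le_right κ₁ (min κ₂ κ₃), min_le_right κ₂ κ₃])
    have hφ₁J := hφ₁0 J
    have hφ₂J := hφ₂0 J
    have hψJ := hψ0 J
    have htri : |fourPt (fluctAtCan F γ b₀ p₀ ε₀ hJK 1) U V W Z| ≤ |Λ| + |fourPt (fluctAtCan F γ b₀ p₀ ε₀ hJK 1) U V W Z - Λ| := by
      have := abs_add_le Λ (fourPt (fluctAtCan F γ b₀ p₀ ε₀ hJK 1) U V W Z - Λ)
      simpa only [add_sub_cancel] using this
    show |((Real.log (ρ U) + B U) - (Real.log (ρ V) + B V)) - ((Real.log (ρ W) + B W) - (Real.log (ρ Z) + B Z))|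
        ≤ (φ₁ J + φ₂ J + ψ J) * Real.exp (-(min κ₁ (min κ₂ κ₃) * d))
    rw [hsplit]
    refine (abs_add_le _ _).trans ?_
    calc |fourPt (fluctAtCan F γ b₀ p₀ ε₀ hJK 1) U V W Z| + |fourPt (fun U => Real.log (ρ U) - Real.log (g U)) U V W Z|
        ≤ (|Λ| + |fourPt (fluctAtCan F γ b₀ p₀ ε₀ hJK 1) U V W Z - Λ|) + ψ J * Real.exp (-(κ₃ * d)) := add_le_add htri hl
      _ ≤ (φ₁ J * Real.exp (-(κ₁ * d)) + φ₂ J * Real.exp (-(κ₂ * d))) + ψ J * Real.exp (-(κ₃ * d)) :=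
          add_le_add (add_le_add hΛ hq) le_rfl
      _ ≤ (φ₁ J * Real.exp (-(min κ₁ (min κ₂ κ₃) * d)) + φ₂ J * Real.exp (-(min κ₁ (min κ₂ κ₃) * d)))
            + ψ J * Real.exp (-(min κ₁ (min κ₂ κ₃) * d)) := by
          gcongr
      _ = (φ₁ J + φ₂ J + ψ J) * Real.exp (-(min κ₁ (min κ₂ κ₃) * d)) := by ring

end Rows

/-! ## §3 The organs EXW / GAP verbatim from v3a and the CORRECTED plumbing signature -/

section Organs

/-- **EXW · WINDOW-WIDE EXACTNESS** — VERBATIM from v3a (organ G-K1aR-2; version-free: it speaks of `fibre`, `histGood`, `regFibrePr`, `minActionRegPr` only).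
[cite: Balaban1985Variational, Thm 1 (8) p.279 and Prop 7 p.299] -/
def WindowExactness : Prop :=
  ∀ (L : ℕ), ∃ pS : ℝ, ∀ (b₀ p₀ : ℝ), 0 < b₀ → pS ≤ p₀ → 0 < p₀ → ∃ ε₁ : ℝ, 0 < ε₁ ∧ ∀ (ε₀ : ℝ), 0 < ε₀ → ε₀ ≤ ε₁ →
    ∃ γ₁ : ℝ, 0 < γ₁ ∧ ∀ (F : T3Family) (γ : ℝ), F.L = L → 0 < γ → γ ≤ γ₁ →
      ∀ (J K : ℕ) (hJK : J ≤ K) (V : GaugeField (F.P J) 0 (Matrix.specialUnitaryGroup (Fin 2) ℂ)), PlaqSmall (θBal F.L γ b₀ p₀ J) V →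
        (∀ U ∈ fibre F ℰp J K hJK V, U ∈ histGood F ℰp (θBal F.L γ b₀ p₀) K J →
            minActionRegPr F J K hJK ε₀ V ≤ wilsonAction4 U) ∧
        (∃ U₀ ∈ regFibrePr F J K hJK ε₀ V, U₀ ∈ histGood F ℰp (θBal F.L γ b₀ p₀) K J ∧
            wilsonAction4 U₀ = minActionRegPr F J K hJK ε₀ V)

/-- The set of action-minimising small-field histories over a datum — VERBATIM from v3a. [cite: Balaban1985Variational, Thm 1 (8) p.279] -/
def argminHist (F : T3Family) (γ b₀ p₀ ε₀ : ℝ) {J K : ℕ} (hJK : J ≤ K) (V : GaugeField (F.P J) 0 (Matrix.specialUnitaryGroup (Fin 2) ℂ)) :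
    Set (GaugeField (F.P K) 0 (Matrix.specialUnitaryGroup (Fin 2) ℂ)) :=
  {U' | U' ∈ fibre F ℰp J K hJK V ∧ U' ∈ histGood F ℰp (θBal F.L γ b₀ p₀) K J ∧ wilsonAction4 U' = minActionRegPr F J K hJK ε₀ V}

/-- **GAP · UNIFORM FIBRE STIFFNESS** — VERBATIM from v3a (version-free). [cite: Balaban1985Variational, (142) p.299; Balaban1984PropagatorsII, (1.33)] -/
def UniformFibreGap : Prop :=
  ∀ (L : ℕ), ∃ pS : ℝ, ∀ (b₀ p₀ : ℝ), 0 < b₀ → pS ≤ p₀ → 0 < p₀ → ∃ ε₁ : ℝ, 0 < ε₁ ∧ ∀ (ε₀ : ℝ), 0 < ε₀ → ε₀ ≤ ε₁ →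
    ∃ γ₁ : ℝ, 0 < γ₁ ∧ ∃ μ : ℝ, 0 < μ ∧ ∀ (F : T3Family) (γ : ℝ), F.L = L → 0 < γ → γ ≤ γ₁ →
      ∀ (J K : ℕ) (hJK : J ≤ K) (V : GaugeField (F.P J) 0 (Matrix.specialUnitaryGroup (Fin 2) ℂ)), PlaqSmall (θBal F.L γ b₀ p₀ J) V →
        ∀ U ∈ fibre F ℰp J K hJK V, U ∈ histGood F ℰp (θBal F.L γ b₀ p₀) K J →
          μ * ((F.L : ℝ)⁻¹) ^ (2 * (K - J)) *
              (⨅ U' : argminHist F γ b₀ p₀ ε₀ hJK V, ∑ ℓ : PBond (F.P K) 0, dist1 (U ℓ * ((U' : GaugeField (F.P K) 0 (Matrix.specialUnitaryGroup (Fin 2) ℂ)) ℓ)⁻¹) ^ 2)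
            ≤ wilsonAction4 U - minActionRegPr F J K hJK ε₀ V

/-- **PLUMBᶜ · THE CORRECTED PLUMBING SIGNATURE** (stub; M–L: v3a's PLUMB content PLUS (R), the existence of a continuous version of the small-field fibre density
on the window): EXW → GAP → 1L4ᶜ. [cite: Balaban1985Variational, Thm 1 (8)-(10) p.279; Balaban1985Averaging, (10) p.19; Dimock2013BalabanII, (282)-(284)] -/
theorem stub_oneLoopPlumbingCan : WindowExactness → UniformFibreGap → OneLoopClusteredCan := by
  intro _ _
  sorry

end Organs

end Summit.QuantumFields.YangMills.Cruxes.FluctuationComparisonRegPrIntL.RunPairOrgan.OneLoop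

end
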